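import Summits.QuantumFields.BalabanUV.Beta.GAN24.UnitCovDecayRate
import Summits.QuantumFields.BalabanUV.T4Continuum.Support.VariationalDelKBridge

/-!
# Row G-an2-4 ∕ (CONV-C), target ledger (O-pos)∕(O-id) — THE INSTANCE `θ = L⁻²` (θ = the SUP-NORM CAUCHY INPUT exponent of `UnitCovDecay.unitCovB_decayCauchy_of_supCauchy`)
# for the unit-lattice readings of Bałaban's (1.18)-averaged free covariance at `U = 1`: the DECAY-WEIGHTED Cauchy rate that comes out is `√θ = L⁻¹` PER STEP
# (wording rule, REF2 advisory R187-2: the decay-weighted rate is `L⁻¹`, never «θ = L⁻² decay-weighted»), AND ITS LIMIT KERNEL — the SHARP sequel of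
# `GAN24/UnitCovDecayRate` (input θ = L⁻¹, output `√(L⁻¹)`), fed by the NE2 lane's variational tower `VariationalDelKBridge.unitCovB_tendsto_sq`
# (a⁻²·Cop(d,4d∕γ₀)·(L⁻²)^k∕(1 − L⁻²), NO hypothesis) instead of lane P1's `opNorm_unitCovB_sub_le` (CQB·L^{−k})

NOT IN PRINT; OUR BOOKKEEPING.  Cell `pub-balaban`, G-an2-4 crux team (2), leaf seat `b2b-balaban-gan24-formalise-leaf-03` (gen 47); LOCATED READING L-gan24leaf03-g47-1
(C3) (`HOME/GAPS.md` § L-gan24leaf03-g47-1): `ROUTES-GAN24.md` v2.1 R0 asked to «carry the rate as a parameter θ in the END … a later sharpening should re-instantiate,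
not re-type» — this file IS that re-instantiation at the block-mean-sharp SUP-NORM exponent (v1.1: header wording only, per REF2 R187-2; the three declarations are byte-identical to v1 p252398).
 * `unitCovB_supCauchy_sq`: `‖(unitCovB (k+j) − unitCovB k) e e′‖ ≤ 4·a⁻²·Cop d (4d∕γ₀)·(L⁻²)^k` (`L ≥ 2`; entry ≤ operator norm,
   triangle through the operator-norm limit of `unitCovB_tendsto_sq`, `1∕(1 − L⁻²) ≤ 2`);
 * **`unitCovB_decayCauchy_sq`**: the instance `θ = L⁻²`, `ε = 4·a⁻²·Cop d (4d∕γ₀)` of `UnitCovDecay.unitCovB_decayCauchy_of_supCauchy`: ONE pair `κ, C > 0` depending on `(d, a)`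
   only with, for every `L ≥ 2`, `M_μ ≥ 2`: `‖unitCovB k e e′‖ ≤ C·e^{−κ·ldist}` ∧ `‖(unitCovB (k+j) − unitCovB k) e e′‖ ≤ C·(L⁻¹)^k·e^{−(κ∕2)·ldist(e.1, e′.1)}`
   — per-step decay-weighted rate `√(L⁻²) = L⁻¹` (the θ = L⁻¹ file: `√(L⁻¹)`);
 * **`unitCovB_limit_decay_sq`**: for ANY operator-norm limit `c_∞` of the tower (it exists: `VariationalDelKBridge.unitCovB_tendsto_sq` ∕ `BalabanAveragedTowerUnit.unitCovB_tendsto`):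
   `‖c_∞ e e′‖ ≤ C·e^{−κ·ldist}` ∧ `‖(unitCovB k − c_∞) e e′‖ ≤ C·(L⁻¹)^k·e^{−(κ∕2)·ldist}`.
HONEST FRAMING as in `UnitCovDecay(Rate)`: `U = 1`, finite tori, the averaged FREE covariance only, block-mean (unit-index) readings; [folklore] over tree modules BY NAME
(`UnitCovDecay`, `UnitCovDecayRate.entry_tendsto`, `VariationalDelKBridge`, `BalabanAveragedTowerUnit.norm_entry_le_opNorm`); no `def … : Prop`; nothing printed used; 0 sorry;
κ EXISTENTIAL; constants OURS; no identification of `c_∞` with a continuum ∕ perfect-lattice object; NOT H_k ∕ composites ∕ U ≠ 1 ∕ (CONV-C) as typed; NEVER «G-an2-4 closed»,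
NOT D1, NOT BetaPertH, NOT continuum, NOT Clay.  HONEST DEPENDENCY: continuum YM on T⁴ ⇐ BetaPertH ∧ nine spine estimates (0/9 proved); BetaPertH ⇐ (D1) ∧ (D4) ∧
CAP+tail; G-an2-4 gates asym, D1 and NE2/3/4.
-/

noncomputable section

namespace Summit.QuantumFields.BalabanUV.Beta.GAN24.UnitCovDecayRateSq

open scoped Matrix Matrix.Norms.L2Operator Topology
open Filter
open Literature.MathematicalPhysics.QuantumFieldTheory.Balaban1983to89
open B5Prop11Plancherel (Tor fine)
open B5G183RateUnitTower (lev lev_neZero)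
open Beta.TorusG0Decay (ldist)
open T4GaugeActionRate (gam0 gam0_pos)
open Summit.QuantumFields.BalabanUV.T4Continuum.VariationalTower (Cop)
open Summit.QuantumFields.BalabanUV.T4Continuum.VariationalDelKBridge (unitCovB_tendsto_sq)
open Summit.QuantumFields.BalabanUV.T4Continuum.BalabanAveragedTowerUnit (idx unitCovB norm_entry_le_opNorm)
open Summit.QuantumFields.BalabanUV.Beta.GAN24.UnitCovDecay (unitCovB_decayCauchy_of_supCauchy)
open Summit.QuantumFields.BalabanUV.Beta.GAN24.UnitCovDecayRate (entry_tendsto)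

variable {d : ℕ} (L : ℕ) [NeZero L] (M : Fin d → ℕ) [hM : ∀ μ, NeZero (M μ)] (a : ℝ) (ha : 0 < a)

/-- **the entrywise sup-norm Cauchy rate at `θ = L⁻²`**: `‖(unitCovB (k+j) − unitCovB k) e e′‖ ≤ 4·a⁻²·Cop·(L⁻²)^k` for `L ≥ 2` (entry ≤ operator norm; triangle through
the operator-norm limit of `unitCovB_tendsto_sq`; `1∕(1 − L⁻²) ≤ 2`; the `j`-term is bounded by the `k`-term since `(L⁻²)^(k+j) ≤ (L⁻²)^k`). [folklore] -/
theorem unitCovB_supCauchy_sq (hL : 2 ≤ L) (k j : ℕ) (e e' : idx L M 0) :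
    ‖(unitCovB L M a ha (k + j) - unitCovB L M a ha k) e e'‖ ≤ 4 * ((a⁻¹) ^ 2 * Cop d (4 * d / gam0 d)) * (((L : ℝ) ^ 2)⁻¹) ^ k := by
  obtain ⟨cinf, _, hrate⟩ := unitCovB_tendsto_sq L M a ha hL
  set ρ : ℝ := ((L : ℝ) ^ 2)⁻¹ with hρ
  set C : ℝ := (a⁻¹) ^ 2 * Cop d (4 * d / gam0 d) with hC
  have hL1 : (2 : ℝ) ≤ L := by exact_mod_cast hL
  have hρ0 : 0 ≤ ρ := by positivity
  have hρle : ρ ≤ 1 / 4 := by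
    rw [hρ, inv_eq_one_div]; exact one_div_le_one_div_of_le (by norm_num) (by nlinarith)
  have hC0 : 0 ≤ C := by rw [hC]; unfold Cop; have := gam0_pos d; positivity
  have hden : 0 < 1 - ρ := by linarith
  have h1 : ‖(unitCovB L M a ha (k + j) - unitCovB L M a ha k) e e'‖ ≤ ‖unitCovB L M a ha (k + j) - unitCovB L M a ha k‖ :=
    norm_entry_le_opNorm _ _ _
  have h2 : ‖unitCovB L M a ha (k + j) - unitCovB L M a ha k‖ ≤ C * ρ ^ (k + j) / (1 - ρ) + C * ρ ^ k / (1 - ρ) := by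
    calc ‖unitCovB L M a ha (k + j) - unitCovB L M a ha k‖
        = ‖(unitCovB L M a ha (k + j) - cinf) - (unitCovB L M a ha k - cinf)‖ := by congr 1; abel
      _ ≤ ‖unitCovB L M a ha (k + j) - cinf‖ + ‖unitCovB L M a ha k - cinf‖ := norm_sub_le _ _
      _ ≤ _ := add_le_add (hrate (k + j)) (hrate k)
  have h3 : C * ρ ^ (k + j) / (1 - ρ) ≤ C * ρ ^ k / (1 - ρ) := by
    refine div_le_div_of_nonneg_right (mul_le_mul_of_nonneg_left ?_ hC0) hden.le
    rw [pow_add]; exact mul_le_of_le_one_right (pow_nonneg hρ0 k) (pow_le_one₀ hρ0 (by linarith))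
  have h4 : C * ρ ^ k / (1 - ρ) ≤ 2 * C * ρ ^ k := by
    rw [div_le_iff₀ hden]
    have h0 : 0 ≤ C * ρ ^ k := mul_nonneg hC0 (pow_nonneg hρ0 k)
    nlinarith
  calc ‖(unitCovB L M a ha (k + j) - unitCovB L M a ha k) e e'‖ ≤ 2 * C * ρ ^ k + 2 * C * ρ ^ k := by linarith
    _ = 4 * ((a⁻¹) ^ 2 * Cop d (4 * d / gam0 d)) * ρ ^ k := by rw [hC]; ring

/-- **THE DECAY-WEIGHTED CAUCHY RATE AT `θ = L⁻²`** (the instance `θ = L⁻²`, `ε = 4·a⁻²·Cop d (4d∕γ₀)` of `UnitCovDecay.unitCovB_decayCauchy_of_supCauchy`): ONE pair `κ, C > 0`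
depending on `(d, a)` only such that for every `L ≥ 2`, every torus with `M_μ ≥ 2`: uniform decay `‖unitCovB k e e′‖ ≤ C·e^{−κ·ldist}` AND
`‖(unitCovB (k+j) − unitCovB k) e e′‖ ≤ C·(L⁻¹)^k·e^{−(κ∕2)·ldist(e.1, e′.1)}` — per-step decay-weighted rate `√(L⁻²) = L⁻¹` (leaf-04's v1 instance: `√(L⁻¹)`).
[folklore] -/
theorem unitCovB_decayCauchy_sq :
    ∃ κ C : ℝ, 0 < κ ∧ 0 < C ∧ ∀ (L : ℕ) [NeZero L] (M : Fin d → ℕ) [∀ μ, NeZero (M μ)], 2 ≤ L → (∀ μ, 2 ≤ M μ) →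
      (∀ (k : ℕ) (e e' : idx L M 0), ‖unitCovB L M a ha k e e'‖ ≤ C * Real.exp (-(κ * ldist (fine (lev L 0) M) e.1 e'.1))) ∧
      ∀ (k j : ℕ) (e e' : idx L M 0), ‖(unitCovB L M a ha (k + j) - unitCovB L M a ha k) e e'‖
          ≤ C * ((L : ℝ)⁻¹) ^ k * Real.exp (-(κ / 2 * ldist (fine (lev L 0) M) e.1 e'.1)) := by
  obtain ⟨κ, C, hκ, hC, h⟩ := unitCovB_decayCauchy_of_supCauchy (d := d) a ha
  have hK0 : 0 ≤ 4 * ((a⁻¹) ^ 2 * Cop d (4 * d / gam0 d)) := by unfold Cop; have := gam0_pos d; positivity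
  refine ⟨κ, C + Real.sqrt (2 * C * (4 * ((a⁻¹) ^ 2 * Cop d (4 * d / gam0 d)))), hκ, by positivity, ?_⟩
  intro L _ M _ hL hM2
  obtain ⟨hdec, hgen⟩ := h L M hM2
  have hCle : C ≤ C + Real.sqrt (2 * C * (4 * ((a⁻¹) ^ 2 * Cop d (4 * d / gam0 d)))) := le_add_of_nonneg_right (Real.sqrt_nonneg _)
  refine ⟨fun k e e' => (hdec k e e').trans (mul_le_mul_of_nonneg_right hCle (Real.exp_pos _).le), fun k j e e' => ?_⟩
  have hθ0 : (0 : ℝ) ≤ ((L : ℝ) ^ 2)⁻¹ := by positivity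
  have hmain := hgen (((L : ℝ) ^ 2)⁻¹) (4 * ((a⁻¹) ^ 2 * Cop d (4 * d / gam0 d))) hθ0 hK0
    (fun k j e e' => unitCovB_supCauchy_sq L M a ha hL k j e e') k j e e'
  -- `√(L⁻²) = L⁻¹`
  have hsqrt : Real.sqrt (((L : ℝ) ^ 2)⁻¹) = (L : ℝ)⁻¹ := by
    rw [Real.sqrt_inv, Real.sqrt_sq (Nat.cast_nonneg _)]
  rw [hsqrt] at hmain
  refine hmain.trans (mul_le_mul_of_nonneg_right (mul_le_mul_of_nonneg_right ?_ (pow_nonneg (inv_nonneg.mpr (Nat.cast_nonneg _)) k))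
    (Real.exp_pos _).le)
  exact le_add_of_nonneg_left hC.le


/-- **THE LIMIT KERNEL DECAYS AND IS APPROACHED AT THE SHARP DECAY-WEIGHTED RATE** (same `κ, C` as `unitCovB_decayCauchy_sq`; `L ≥ 2`, `M_μ ≥ 2`; `c_∞` any
operator-norm limit of the tower): `‖c_∞ e e′‖ ≤ C·e^{−κ·ldist}` ∧ `‖(unitCovB k − c_∞) e e′‖ ≤ C·(L⁻¹)^k·e^{−(κ∕2)·ldist}` — the shape
«|𝒦^{(k)} − 𝒦^{(∞)}|(y,y′) ≤ c₀θ^k e^{−δ|y−y′|}» with θ = L⁻¹ per step (the proof of `UnitCovDecayRate.unitCovB_limit_decay`, verbatim up to the rate letter). [folklore] -/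
theorem unitCovB_limit_decay_sq :
    ∃ κ C : ℝ, 0 < κ ∧ 0 < C ∧ ∀ (L : ℕ) [NeZero L] (M : Fin d → ℕ) [∀ μ, NeZero (M μ)], 2 ≤ L → (∀ μ, 2 ≤ M μ) →
      ∀ cinf : Matrix (idx L M 0) (idx L M 0) ℂ, Tendsto (unitCovB L M a ha) atTop (𝓝 cinf) →
        (∀ e e' : idx L M 0, ‖cinf e e'‖ ≤ C * Real.exp (-(κ * ldist (fine (lev L 0) M) e.1 e'.1))) ∧
        ∀ (k : ℕ) (e e' : idx L M 0), ‖(unitCovB L M a ha k - cinf) e e'‖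
          ≤ C * ((L : ℝ)⁻¹) ^ k * Real.exp (-(κ / 2 * ldist (fine (lev L 0) M) e.1 e'.1)) := by
  obtain ⟨κ, C, hκ, hC, h⟩ := unitCovB_decayCauchy_sq (d := d) a ha
  refine ⟨κ, C, hκ, hC, ?_⟩
  intro L _ M _ hL hM2 cinf hlim
  obtain ⟨hdec, hcau⟩ := h L M hL hM2
  have hent : ∀ e e' : idx L M 0, Tendsto (fun k => ‖(unitCovB L M a ha k - cinf) e e'‖) atTop (𝓝 0) :=
    fun e e' => entry_tendsto hlim e e'
  refine ⟨fun e e' => ?_, fun k e e' => ?_⟩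
  · refine le_of_forall_pos_lt_add fun ε hε => ?_
    obtain ⟨k, hk⟩ := ((hent e e').eventually (gt_mem_nhds hε)).exists
    have hsplit : cinf e e' = unitCovB L M a ha k e e' - (unitCovB L M a ha k - cinf) e e' := by
      rw [Matrix.sub_apply]; ring
    calc ‖cinf e e'‖ ≤ ‖unitCovB L M a ha k e e'‖ + ‖(unitCovB L M a ha k - cinf) e e'‖ := by
          rw [hsplit]; exact (norm_sub_le _ _).trans (by rw [Matrix.sub_apply])
      _ < C * Real.exp (-(κ * ldist (fine (lev L 0) M) e.1 e'.1)) + ε := add_lt_add_of_le_of_lt (hdec k e e') hk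
  · refine le_of_forall_pos_lt_add fun ε hε => ?_
    obtain ⟨j, hj⟩ := (((hent e e').comp (tendsto_add_atTop_nat k)).eventually (gt_mem_nhds hε)).exists
    have hsplit : (unitCovB L M a ha k - cinf) e e'
        = -((unitCovB L M a ha (k + j) - unitCovB L M a ha k) e e') + (unitCovB L M a ha (j + k) - cinf) e e' := by
      simp only [Matrix.sub_apply, add_comm j k]; ring
    calc ‖(unitCovB L M a ha k - cinf) e e'‖
        ≤ ‖(unitCovB L M a ha (k + j) - unitCovB L M a ha k) e e'‖ + ‖(unitCovB L M a ha (j + k) - cinf) e e'‖ := by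
          rw [hsplit]; exact (norm_add_le _ _).trans (by rw [norm_neg])
      _ < C * ((L : ℝ)⁻¹) ^ k * Real.exp (-(κ / 2 * ldist (fine (lev L 0) M) e.1 e'.1)) + ε :=
          add_lt_add_of_le_of_lt (hcau k j e e') hj

end Summit.QuantumFields.BalabanUV.Beta.GAN24.UnitCovDecayRateSq

end
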